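import Literature.Geometry.Riemannian.ColdingMinicozziEntropyValues
import Literature.Geometry.Riemannian.CylinderEntropy
import HarnessLib

/-!
# Proof of Stone's entropy values for the generalized cylinders (`Stone1994_cylinderEntropy_holds`)

Discharge of the named fact `Stone1994_cylinderEntropy` of `ColdingMinicozziEntropyValues.lean`:
for `1 ≤ k ≤ n`, `gaussianEntropy n (shrinkingCylinder n k) = ofReal (sphereEntropy k)`, i.e.
`λ(S^k_{√(2k)} × ℝ^{n-k}) = Λ_k = |S^k| (k/(2πe))^{k/2}`.

The abstract statement for a round cylinder `{‖P_V z‖ = √(2k)}` over a `(k+1)`-dimensional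
subspace `V` of an `(n+1)`-dimensional real inner product space is
`gaussianEntropy_shrinkingCylinder_abstract` (`CylinderEntropy.lean`), assembled from

* the area formula for round spheres, `μHE[k] (S^k_r) = r^k · 2π^{(k+1)/2}/Γ((k+1)/2)`
  (`SphereAreaGeneral.lean`), and the product structure of the Hausdorff measure of the round
  cylinder, `μHE[n]⌊(S_V(r) × Vᗮ) = μHE[k]⌊S_V(r) ⊗ vol` (`CylinderHausdorff*.lean`: Christensen's
  lemma for the uniformly distributed measures on the cylinder plus a Lipschitz-graph squeeze);
* Colding–Minicozzi's theorem that the entropy of the self-shrinking sphere is achieved at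
  `(x₀, t₀) = (0, 1)` (2012, Lemma 7.10), proved for round spheres along their paths
  `(s y, 1 + a s²)` using only the rotation invariance of `μHE[k]`
  (`SphereRotationInvariance.lean`, `ShrinkingSphereMonotonicity.lean`,
  `ShrinkingSphereEntropy.lean`);
* `λ(Σ × ℝ^{n-k}) = λ(Σ)` for `Σ = S^k` (Colding–Ilmanen–Minicozzi–White 2013, Introduction;
  `CylinderEntropy.lean`).

Here the coordinate cylinder `shrinkingCylinder n k = {x | x₀² + ⋯ + x_k² = 2k}` of
`EuclideanSpace ℝ (Fin (n+1))` is identified with `{‖P_V x‖ = √(2k)}` for `V` the span of the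
first `k + 1` coordinate vectors (`shrinkingCylinder_eq_setOf_norm_orthogonalProjectionOnto`),
and the fact follows (`Stone1994_cylinderEntropy_holds`).

## References

* A. Stone, *A density function and the structure of singularities of the mean curvature flow*,
  Calc. Var. PDE 2 (1994) 443–480, Appendix A. [Stone1994]
* T. H. Colding, W. P. Minicozzi II, *Generic mean curvature flow I; generic singularities*,
  Ann. of Math. 175 (2012) 755–833, Remark 1.7, §7.2 Lemma 7.10. [ColdingMinicozzi2012]
* T. H. Colding, T. Ilmanen, W. P. Minicozzi II, B. White, *The round sphere minimizes entropy
  among closed self-shrinkers*, J. Differential Geom. 95 (2013) 53–69, Introduction.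
  [ColdingIlmanenMinicozziWhite2013]
-/

noncomputable section

open Set Metric Module Submodule Filter Function
open _root_.MeasureTheory _root_.MeasureTheory.Measure
open scoped ENNReal NNReal Topology RealInnerProductSpace Pointwise

namespace Literature.Geometry.Riemannian

/-- **The coordinate subspace of the first `k + 1` coordinates.** For `k ≤ n` there is a subspace
`V` of `EuclideanSpace ℝ (Fin (n+1))` of dimension `k + 1` whose orthogonal projection is the
truncation `x ↦ (x₀, …, x_k, 0, …, 0)`: `‖P_V x‖² = x₀² + ⋯ + x_k²`. [folklore] -/
theorem exists_submodule_norm_sq_orthogonalProjectionOnto_eq (n k : ℕ) (hkn : k ≤ n) :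
    ∃ V : Submodule ℝ (EuclideanSpace ℝ (Fin (n + 1))), finrank ℝ V = k + 1 ∧
      ∀ x : EuclideanSpace ℝ (Fin (n + 1)),
        ‖V.orthogonalProjectionOnto x‖ ^ 2 = ∑ i : Fin (n + 1), (if (i : ℕ) ≤ k then x i ^ 2 else 0) := by
  -- the embedding of `ℝ^{k+1}` as the first `k + 1` coordinates
  have hlt : ∀ {i : ℕ}, i ≤ k → i < k + 1 := fun h ↦ Nat.lt_succ_of_le h
  set ι : EuclideanSpace ℝ (Fin (k + 1)) →ₗ[ℝ] EuclideanSpace ℝ (Fin (n + 1)) :=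
    { toFun := fun y ↦ WithLp.toLp 2 fun i : Fin (n + 1) ↦
        if h : (i : ℕ) ≤ k then y ⟨i, hlt h⟩ else 0
      map_add' := fun y y' ↦ by
        ext i
        simp only [PiLp.add_apply]
        split_ifs <;> simp
      map_smul' := fun c y ↦ by
        ext i
        simp only [PiLp.smul_apply, smul_eq_mul, RingHom.id_apply]
        split_ifs <;> simp } with hι_def
  have hι : ∀ (y : EuclideanSpace ℝ (Fin (k + 1))) (i : Fin (n + 1)),
      ι y i = if h : (i : ℕ) ≤ k then y ⟨i, hlt h⟩ else 0 := fun y i ↦ rfl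
  have hinj : Function.Injective ι := by
    intro y y' h
    ext j
    have hj : (j : ℕ) ≤ k := Nat.le_of_lt_succ j.2
    have hjn : (j : ℕ) < n + 1 := by omega
    have := congrArg (fun z : EuclideanSpace ℝ (Fin (n + 1)) ↦ z ⟨j, hjn⟩) h
    simp only [hι, hj, dite_true] at this
    exact this
  set V : Submodule ℝ (EuclideanSpace ℝ (Fin (n + 1))) := LinearMap.range ι with hV_def
  have hVrank : finrank ℝ V = k + 1 := by
    rw [hV_def, LinearMap.finrank_range_of_inj hinj, finrank_euclideanSpace_fin]
  refine ⟨V, hVrank, fun x ↦ ?_⟩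
  -- the truncation of `x` and the projection
  set y : EuclideanSpace ℝ (Fin (k + 1)) := WithLp.toLp 2 fun j : Fin (k + 1) ↦
    x ⟨j, by omega⟩ with hy_def
  have hTx : ∀ i : Fin (n + 1), ι y i = if (i : ℕ) ≤ k then x i else 0 := by
    intro i
    rw [hι]
    split_ifs with h
    · rfl
    · rfl
  have hmem : ι y ∈ V := LinearMap.mem_range_self ι y
  have horth : x - ι y ∈ Vᗮ := by
    rw [Submodule.mem_orthogonal]
    rintro u ⟨y', rfl⟩
    rw [PiLp.inner_apply]
    refine Finset.sum_eq_zero fun i _ ↦ ?_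
    simp only [PiLp.sub_apply, hTx, hι]
    split_ifs with h <;> simp
  have hproj : (V.orthogonalProjectionOnto x : EuclideanSpace ℝ (Fin (n + 1))) = ι y := by
    rw [← starProjection_apply]
    exact eq_starProjection_of_mem_orthogonal hmem horth
  rw [show ‖V.orthogonalProjectionOnto x‖ = ‖(V.orthogonalProjectionOnto x : EuclideanSpace ℝ (Fin (n + 1)))‖
      from rfl, hproj, EuclideanSpace.real_norm_sq_eq]
  refine Finset.sum_congr rfl fun i _ ↦ ?_
  rw [hTx]
  split_ifs <;> simp

/-- **The coordinate cylinder is a round cylinder**: for `k ≤ n` there is a `(k+1)`-dimensional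
subspace `V ≤ ℝ^{n+1}` with `shrinkingCylinder n k = {x | ‖P_V x‖ = √(2k)}`. [folklore] -/
theorem shrinkingCylinder_eq_setOf_norm_orthogonalProjectionOnto (n k : ℕ) (hkn : k ≤ n) :
    ∃ V : Submodule ℝ (EuclideanSpace ℝ (Fin (n + 1))), finrank ℝ V = k + 1 ∧
      shrinkingCylinder n k =
        {x : EuclideanSpace ℝ (Fin (n + 1)) | ‖V.orthogonalProjectionOnto x‖ = Real.sqrt (2 * k)} := by
  obtain ⟨V, hV, hnorm⟩ := exists_submodule_norm_sq_orthogonalProjectionOnto_eq n k hkn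
  refine ⟨V, hV, ?_⟩
  ext x
  rw [mem_shrinkingCylinder, mem_setOf_eq, ← hnorm x]
  constructor
  · intro h
    rw [← Real.sqrt_sq (norm_nonneg (V.orthogonalProjectionOnto x)), h]
  · intro h
    rw [h, Real.sq_sqrt (by positivity)]

/-- **Stone's entropy values for the generalized self-shrinking cylinders** (discharge of the named
fact `Stone1994_cylinderEntropy`): for `1 ≤ k ≤ n`,
`λ(S^k_{√(2k)} × ℝ^{n-k}) = Λ_k = |S^k| (k/(2πe))^{k/2}`, i.e.
`gaussianEntropy n (shrinkingCylinder n k) = ofReal (sphereEntropy k)` (Stone 1994, Appendix A;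
Colding–Minicozzi 2012, Lemma 7.10; Colding–Ilmanen–Minicozzi–White 2013, Introduction:
"In [St], Stone computed the `F` functional, and therefore the entropy, for generalized cylinders
`S^k × R^{n-k}`"). [cite: ColdingIlmanenMinicozziWhite2013, Introduction] -/
theorem Stone1994_cylinderEntropy_holds : Stone1994_cylinderEntropy := by
  intro n k hk hkn
  obtain ⟨V, hV, hCyl⟩ := shrinkingCylinder_eq_setOf_norm_orthogonalProjectionOnto n k hkn
  rw [hCyl]
  exact gaussianEntropy_shrinkingCylinder_abstract V (finrank_euclideanSpace_fin (𝕜 := ℝ) (n := n + 1))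
    hV hk

end Literature.Geometry.Riemannian

end
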